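/-
Copyright (c) 2026 the pub-hodgecm-mathlib formalisation cell (harness21).  Prover seat hodgecm-mathlib-LH4-p10 (g2), req620 Track A «(D-RAM) FOUR-FRAME» squad
(MS ROAD A, Stage B lead; B10₂ «TYPE-2 STABLE COUNT», WEIGHT-GENERIC ASSEMBLY after the 2026-09-04T00:53Z re-key of the type-2 half on multiplicity).  2026-09-04.
-/
import Summits.HodgeConjecture.HodgeConjecture.Theorems.F0P3cDyRamStableCountTypeZero              -- ★ B10 (this seat) p856280: `finite_normalisedStableLattices`; brings ★ PART 1, ★ PART 2 FILE 3, ★ B3, ★ StrataDefs ED. 2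
import HarnessLib

/-!
# Crux `H413`, MS ROAD A, STAGE B — B10₂ «THE TYPE-2 STABLE COUNT», WEIGHT-GENERIC ASSEMBLY: `Σᶠ_{M ∈ 𝓛₀(T)} f M = (q^k − 1)∕(q − 1)` from the type-2 stratum table of `f`

Cell `hodgecm-mathlib` (D-0151), FLOOR 0, crux item H413 = `stmt-HodgeConjecture-24833`, route of record `HCCMUnconditional`; lane `--supports stmt-HodgeConjecture-24833 --as helper`
(count-neutral).  THEOREMS ONLY (no `def`, no instance, no notation, no `sorry`).

WHY GENERIC.  The type-2 half of (MS) was RE-KEYED ON MULTIPLICITY (LH4-p09 (g2) flag 2026-09-04T00:42:58Z, LH4-p11 (g2) ruling 00:53Z, this seat's ratification +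
counter-computation 00:58Z: at ℚ₂(√2), key (7,5,5), `Σ_{pol₂} n₂·w = 255 = [8]₂` but `Σ_{pol₂} w = 239`; the glued stratum `(5,7,7)` carries `n₂ = 2 = q` classes of polarisations).  The
Stage-B₂ weight is therefore `f M = n₂(M)·stabiliserWeight σ M` with `n₂ = polarisationCount σ ϖ 2` (★-to-be StrataDefs ED. 3), not the indicator weight of skeleton₂ v1
08e5e6e2d02c47d3.  The ASSEMBLY, however, never looks inside the weight: it is the partition by axis vector (★ PART 1, any `f`), the type-2 shape list (B3₂-γ), the per-stratum
table (the type-2 sockets, any `f`), and ★ PART 2 `sum_box_mul_eq_typeTwo` (any `v`).  This file proves it ONCE for an arbitrary weight `f : lattice → ℚ` vanishing off the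
type-2-polarisable part of `𝓛₀(T)`; the B10₂-MULT head (the `hB10₂` binder of LH4-p11 (g2)'s `stableModelSum_of_stageB_mult`) is the instance
`f := fun M => (polarisationCount σ ϖ 2 M : ℚ) * stabiliserWeight σ M` fed with the re-keyed ★ sockets, by `exact`.
* `finsum_mem_eq_finsum_mem_sep_of_eq_zero` — a weight vanishing off a sub-predicate may be summed over the sub-part.
* `finsum_stratumTwo_eq_zero_of_not_shape` — type-2 strata off the B3₂-γ shape list weigh `0` (given the shape list as a hypothesis).
* `finsum_mem_normalisedStableLattices_eq_of_typeTwo_table` — HEAD (generic B10₂): the table for `f` on the type-2 strata ⟹ `Σᶠ_{𝓛₀(T)} f = (q^k − 1)∕(q − 1)`.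
HONEST LABEL.  Count-neutral; `HC_CM` is proved only modulo the 7 printed citations (2 remaining named inputs: hLiu418 = `stmt-HodgeConjecture-24832`, h413 = `stmt-HodgeConjecture-24833`) until rung 0 closes.

## References
* [Kottwitz1986BaseChangeUnits] R. Kottwitz, *Base change for unit elements of Hecke algebras*, Compositio Math. 60 (1986), §1 pp. 240–241 (counting fixed lattices by position).
* [Rogawski1990] J. Rogawski, *Automorphic representations of unitary groups in three variables*, Ann. of Math. Stud. 123 (1990), §4.9 Prop. 4.9.1 (a) p. 55 (the stable count).
-/

set_option autoImplicit false

noncomputable section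

namespace Summit.HodgeConjecture.HodgeConjecture.Cruxes.H413.F0P3cDyRamStableCountTypeTwoGeneric

open Finset
open Literature.NumberTheory.Automorphic Literature.NumberTheory.Automorphic.HermitianLattice
open Literature.NumberTheory.Automorphic.UnitaryLatticeTree Literature.NumberTheory.Automorphic.UnitaryThreeFourFrame
open Summit.HodgeConjecture.HodgeConjecture.Cruxes.H413.F0P3cDyRamDiagonalTorusDefs
open Summit.HodgeConjecture.HodgeConjecture.Cruxes.H413.F0P3cDyRamDiagonalStrataDefs
open Summit.HodgeConjecture.HodgeConjecture.Cruxes.H413.F0P3cDyRamStrataPartition (finsum_mem_eq_sum_box_finsum_mem_hasAxis)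
open Summit.HodgeConjecture.HodgeConjecture.Cruxes.H413.F0P3cDyRamDiagonalStrataAxis (exists_hasAxis hasAxis_unique)
open Summit.HodgeConjecture.HodgeConjecture.Cruxes.H413.F0P3cDyRamElementDatumParity
open Summit.HodgeConjecture.HodgeConjecture.Cruxes.H413.F0P3cDyRamStableCountBoxReindexTypes (sum_box_mul_eq_typeTwo)
open Summit.HodgeConjecture.HodgeConjecture.Cruxes.H413.F0P3cDyRamStableCountTypeZero (finite_normalisedStableLattices)
open scoped Valued WithZero Matrix MatrixGroups

variable {K : Type} [Field K] [Valued K ℤᵐ⁰]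

/-! ## §1  Two small summation facts -/

/-- A weight `f` vanishing at the members of `S` failing `P` may be summed over `{M ∈ S | P M}` instead of `S`. [folklore] -/
theorem finsum_mem_eq_finsum_mem_sep_of_eq_zero {ι : Type*} (S : Set ι) (P : ι → Prop) (f : ι → ℚ) (hf : ∀ x ∈ S, ¬ P x → f x = 0) :
    ∑ᶠ x ∈ S, f x = ∑ᶠ x ∈ {x | x ∈ S ∧ P x}, f x := by
  have hset : S ∩ Function.support f = {x | x ∈ S ∧ P x} ∩ Function.support f := by
    ext x
    simp only [Set.mem_inter_iff, Set.mem_setOf_eq, Function.mem_support]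
    exact ⟨fun ⟨hS, hne⟩ => ⟨⟨hS, by_contra fun hP => hne (hf x hS hP)⟩, hne⟩, fun ⟨⟨hS, _⟩, hne⟩ => ⟨hS, hne⟩⟩
  rw [← finsum_mem_inter_support f S, hset, finsum_mem_inter_support]

/-- A type-2 stratum whose axis vector is OFF the B3₂-γ shape list (given as the hypothesis `hshapes`) is empty, hence weighs `0` for any weight.
[cite: Kottwitz1986BaseChangeUnits, §1 pp. 240–241] -/
theorem finsum_stratumTwo_eq_zero_of_not_shape {σ : K →+* K} {ϖ : K} (T : GL (Fin 3) K) (f : Submodule 𝒪[K] (Fin 3 → K) → ℚ)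
    (hshapes : ∀ {M : Submodule 𝒪[K] (Fin 3 → K)} {a : Fin 3 → ℕ}, M ∈ normalisedStableLattices T → IsTypeTwoPolarisable σ ϖ M → HasAxis ϖ M a →
      (∃ s, ¬ 2 ∣ s ∧ (a = ![0, s, s] ∨ a = ![s, 0, s] ∨ a = ![s, s, 0])) ∨
      (∃ ρ s, 2 ∣ s ∧ 2 ≤ s ∧ (a = ![2 * ρ + 1, 2 * ρ + 1 + s, 2 * ρ + 1 + s] ∨ a = ![2 * ρ + 1 + s, 2 * ρ + 1, 2 * ρ + 1 + s] ∨
        a = ![2 * ρ + 1 + s, 2 * ρ + 1 + s, 2 * ρ + 1])) ∨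
      (∃ ρ, a = ![2 * ρ + 1, 2 * ρ + 1, 2 * ρ + 1]))
    (a : Fin 3 → ℕ)
    (ha : ¬ ((∃ s, ¬ 2 ∣ s ∧ (a = ![0, s, s] ∨ a = ![s, 0, s] ∨ a = ![s, s, 0])) ∨
      (∃ ρ s, 2 ∣ s ∧ 2 ≤ s ∧ (a = ![2 * ρ + 1, 2 * ρ + 1 + s, 2 * ρ + 1 + s] ∨ a = ![2 * ρ + 1 + s, 2 * ρ + 1, 2 * ρ + 1 + s] ∨
        a = ![2 * ρ + 1 + s, 2 * ρ + 1 + s, 2 * ρ + 1])) ∨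
      (∃ ρ, a = ![2 * ρ + 1, 2 * ρ + 1, 2 * ρ + 1]))) :
    ∑ᶠ M ∈ stratumTwo σ ϖ T a, f M = 0 := by
  have hempty : stratumTwo σ ϖ T a = ∅ :=
    Set.eq_empty_of_forall_notMem fun M hM => by
      obtain ⟨hM₀, hpol, hax⟩ := (mem_stratumTwo_iff σ ϖ T a M).1 hM
      exact ha (hshapes hM₀ hpol hax)
  rw [hempty, finsum_mem_empty]

/-! ## §2  HEAD — the weight-generic B10₂ assembly -/

/-- **B10₂, WEIGHT-GENERIC.**  At a ramified quadratic datum and an element datum above the datum depth, `T = diag(α, β, 1)`, shift `2k + d = n₁ + n₂ + n₃ + 2`: let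
`f : lattice → ℚ` be ANY weight vanishing at the members of `𝓛₀(T)` that are not type-2-polarisable, whose sums over the type-2 strata `stratumTwo σ ϖ T a` follow the
Stage-B₂ table — on-branch `T₁∕T₂∕T₃(s)`: `q^{s∕2}·[s odd, s ≤ nᵢ]`; glued `Gᵢ(2ρ+1, s)`: tube `(q−1)q^{2ρ+s∕2}` + glue shell; core-hanging `H(2ρ+1)`: `(q−2)q^{2ρ}` + equilateral glue —
and let the B3₂-γ shape list hold.  Then `Σᶠ_{M ∈ 𝓛₀(T)} f M = (q^k − 1)∕(q − 1)`.  (Instance of record: `f M = polarisationCount σ ϖ 2 M · stabiliserWeight σ M`, the multiplicity-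
weighted class count of the re-keyed type-2 half of (MS).)  Proof: restrict to the polarisable part (§1), partition by axis vector over the box `[0, n₁+n₂+n₃]³` (★ PART 1, ★ B3-α
`exists_hasAxis`, ★ `hasAxis_unique`), cells = `stratumTwo` (★ `mem_stratumTwo_iff`), ★ PART 2 `sum_box_mul_eq_typeTwo` with the table and the shape list, parities ★
`F0P3cDyRamElementDatumParity`, divide by `q − 1 ≠ 0`. [cite: Kottwitz1986BaseChangeUnits, §1 pp. 240–241] [cite: Rogawski1990, §4.9 Prop. 4.9.1 (a) p. 55] -/
theorem finsum_mem_normalisedStableLattices_eq_of_typeTwo_table [Fintype 𝓀[K]] {σ : K →+* K} {ϖ : K} {d t : ℕ} (hD : IsRamifiedQuadraticDatum σ ϖ d t)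
    {α β : K} {N₀ n₁ n₂ n₃ : ℕ} (hE : IsElementDatum σ ϖ N₀ α β n₁ n₂ n₃) (hN₀ : d ≤ N₀)
    (T : GL (Fin 3) K) (hT : (T : Matrix (Fin 3) (Fin 3) K) = Matrix.diagonal ![α, β, 1]) (k : ℕ) (hk : 2 * k + d = n₁ + n₂ + n₃ + 2)
    (f : Submodule 𝒪[K] (Fin 3 → K) → ℚ) (hf0 : ∀ M ∈ normalisedStableLattices T, ¬ IsTypeTwoPolarisable σ ϖ M → f M = 0)
    (hshapes : ∀ {M : Submodule 𝒪[K] (Fin 3 → K)} {a : Fin 3 → ℕ}, M ∈ normalisedStableLattices T → IsTypeTwoPolarisable σ ϖ M → HasAxis ϖ M a →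
      (∃ s, ¬ 2 ∣ s ∧ (a = ![0, s, s] ∨ a = ![s, 0, s] ∨ a = ![s, s, 0])) ∨
      (∃ ρ s, 2 ∣ s ∧ 2 ≤ s ∧ (a = ![2 * ρ + 1, 2 * ρ + 1 + s, 2 * ρ + 1 + s] ∨ a = ![2 * ρ + 1 + s, 2 * ρ + 1, 2 * ρ + 1 + s] ∨
        a = ![2 * ρ + 1 + s, 2 * ρ + 1 + s, 2 * ρ + 1])) ∨
      (∃ ρ, a = ![2 * ρ + 1, 2 * ρ + 1, 2 * ρ + 1]))
    (hT1 : ∀ (s : ℕ), 1 ≤ s → ∑ᶠ M ∈ stratumTwo σ ϖ T ![0, s, s], f M = if ¬ 2 ∣ s ∧ s ≤ n₁ then ((Fintype.card 𝓀[K] : ℚ) ^ (s / 2)) else 0)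
    (hT2 : ∀ (s : ℕ), 1 ≤ s → ∑ᶠ M ∈ stratumTwo σ ϖ T ![s, 0, s], f M = if ¬ 2 ∣ s ∧ s ≤ n₂ then ((Fintype.card 𝓀[K] : ℚ) ^ (s / 2)) else 0)
    (hT3 : ∀ (s : ℕ), 1 ≤ s → ∑ᶠ M ∈ stratumTwo σ ϖ T ![s, s, 0], f M = if ¬ 2 ∣ s ∧ s ≤ n₃ then ((Fintype.card 𝓀[K] : ℚ) ^ (s / 2)) else 0)
    (hG1 : ∀ (ρ s : ℕ), 1 ≤ s → ∑ᶠ M ∈ stratumTwo σ ϖ T ![2 * ρ + 1, 2 * ρ + 1 + s, 2 * ρ + 1 + s], f M =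
      (if 2 ∣ s ∧ 2 * ρ + 1 ≤ min n₂ n₃ ∧ 2 * ρ + 1 + s ≤ n₁ then (((Fintype.card 𝓀[K] : ℚ) - 1) * (Fintype.card 𝓀[K] : ℚ) ^ (2 * ρ + s / 2)) else 0) +
      (if 2 ∣ s ∧ n₂ = n₃ ∧ n₁ = n₂ + s ∧ n₂ < 2 * ρ + 1 ∧ 2 * ρ + 1 ≤ 2 * n₂ ∧ 2 * ρ + 1 - n₂ ≤ n₂ - d + 1
        then ((Fintype.card 𝓀[K] : ℚ) ^ (2 * ρ + 1 + s / 2 - (2 * ρ + 1 - n₂ + 1) / 2)) else 0))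
    (hG2 : ∀ (ρ s : ℕ), 1 ≤ s → ∑ᶠ M ∈ stratumTwo σ ϖ T ![2 * ρ + 1 + s, 2 * ρ + 1, 2 * ρ + 1 + s], f M =
      (if 2 ∣ s ∧ 2 * ρ + 1 ≤ min n₁ n₃ ∧ 2 * ρ + 1 + s ≤ n₂ then (((Fintype.card 𝓀[K] : ℚ) - 1) * (Fintype.card 𝓀[K] : ℚ) ^ (2 * ρ + s / 2)) else 0) +
      (if 2 ∣ s ∧ n₁ = n₃ ∧ n₂ = n₁ + s ∧ n₁ < 2 * ρ + 1 ∧ 2 * ρ + 1 ≤ 2 * n₁ ∧ 2 * ρ + 1 - n₁ ≤ n₁ - d + 1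
        then ((Fintype.card 𝓀[K] : ℚ) ^ (2 * ρ + 1 + s / 2 - (2 * ρ + 1 - n₁ + 1) / 2)) else 0))
    (hG3 : ∀ (ρ s : ℕ), 1 ≤ s → ∑ᶠ M ∈ stratumTwo σ ϖ T ![2 * ρ + 1 + s, 2 * ρ + 1 + s, 2 * ρ + 1], f M =
      (if 2 ∣ s ∧ 2 * ρ + 1 ≤ min n₁ n₂ ∧ 2 * ρ + 1 + s ≤ n₃ then (((Fintype.card 𝓀[K] : ℚ) - 1) * (Fintype.card 𝓀[K] : ℚ) ^ (2 * ρ + s / 2)) else 0) +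
      (if 2 ∣ s ∧ n₁ = n₂ ∧ n₃ = n₁ + s ∧ n₁ < 2 * ρ + 1 ∧ 2 * ρ + 1 ≤ 2 * n₁ ∧ 2 * ρ + 1 - n₁ ≤ n₁ - d + 1
        then ((Fintype.card 𝓀[K] : ℚ) ^ (2 * ρ + 1 + s / 2 - (2 * ρ + 1 - n₁ + 1) / 2)) else 0))
    (hH : ∀ (ρ : ℕ), ∑ᶠ M ∈ stratumTwo σ ϖ T ![2 * ρ + 1, 2 * ρ + 1, 2 * ρ + 1], f M =
      (if 2 * ρ + 1 ≤ min n₁ (min n₂ n₃) then (((Fintype.card 𝓀[K] : ℚ) - 2) * (Fintype.card 𝓀[K] : ℚ) ^ (2 * ρ)) else 0) +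
      (if n₁ = n₂ ∧ n₂ = n₃ ∧ n₁ < 2 * ρ + 1 ∧ 2 * ρ + 1 ≤ 2 * n₁ ∧ 2 * ρ + 1 - n₁ ≤ n₁ - d + 1
        then ((Fintype.card 𝓀[K] : ℚ) ^ (2 * ρ + 1 - (2 * ρ + 1 - n₁ + 1) / 2)) else 0)) :
    ∑ᶠ M ∈ normalisedStableLattices T, f M = ((Fintype.card 𝓀[K] : ℚ) ^ k - 1) / ((Fintype.card 𝓀[K] : ℚ) - 1) := by
  have hϖ : Valued.v ϖ = WithZero.exp (-1 : ℤ) := hD.2.2.1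
  have hd : 1 ≤ d := hD.2.2.2.2.2.1
  -- (0) restrict to the type-2-polarisable part
  rw [finsum_mem_eq_finsum_mem_sep_of_eq_zero (normalisedStableLattices T) (IsTypeTwoPolarisable σ ϖ) f hf0]
  -- (1) the summation set is finite and partitioned by axis vector over the box `[0, n₁+n₂+n₃]³`
  set S : Set (Submodule 𝒪[K] (Fin 3 → K)) := {M | M ∈ normalisedStableLattices T ∧ IsTypeTwoPolarisable σ ϖ M} with hS_def
  have hS : S.Finite := (finite_normalisedStableLattices hD hE T hT).subset fun M hM => hM.1
  have huniq : ∀ (M : Submodule 𝒪[K] (Fin 3 → K)) (a a' : Fin 3 → ℕ), HasAxis ϖ M a → HasAxis ϖ M a' → a = a' :=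
    fun M a a' ha ha' => hasAxis_unique hϖ ha ha'
  have haxis : ∀ M ∈ S, ∃ a : Fin 3 → ℕ, HasAxis ϖ M a ∧ ∀ i, a i ≤ n₁ + n₂ + n₃ :=
    fun M hM => exists_hasAxis hD hE hT hM.1
  rw [finsum_mem_eq_sum_box_finsum_mem_hasAxis huniq S hS (n₁ + n₂ + n₃) haxis]
  -- (2) each cell is a type-2 stratum
  have hcell : ∀ a : Fin 3 → ℕ, {M | M ∈ S ∧ HasAxis ϖ M a} = stratumTwo σ ϖ T a := fun a => by
    ext M
    rw [mem_stratumTwo_iff, Set.mem_setOf_eq, hS_def, Set.mem_setOf_eq, and_assoc]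
  simp_rw [hcell]
  -- (3) the table, cell by cell, and the box re-index + law
  set q : ℕ := Fintype.card 𝓀[K] with hq_def
  obtain ⟨h1, h2', h3⟩ := depth_mod_two_eq_of_isElementDatum hD hE hN₀
  have key := sum_box_mul_eq_typeTwo q hd (isoceles_of_isElementDatum hD hE) (le_min_depth_of_isElementDatum hE hN₀) h1 h2' h3 le_rfl hk
    (fun a => ∑ᶠ M ∈ stratumTwo σ ϖ T a, f M) hT1 hT2 hT3 hG1 hG2 hG3 hH
    (fun a ha => finsum_stratumTwo_eq_zero_of_not_shape T f hshapes a ha)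
  -- (4) divide by `q − 1 ≠ 0`
  have hq1 : (q : ℚ) - 1 ≠ 0 := by
    have : 1 < q := Fintype.one_lt_card
    have : (1 : ℚ) < q := by exact_mod_cast this
    linarith
  rw [eq_div_iff hq1, mul_comm]
  exact key

end Summit.HodgeConjecture.HodgeConjecture.Cruxes.H413.F0P3cDyRamStableCountTypeTwoGeneric

end
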